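import Summits.HodgeConjecture.HodgeConjecture.Theorems.R90S6GRegularCellsU2Hyp        -- ★ C0 p865241: root dichotomy + hyperbolic cell (`normOne_or_hyperbolic_of_eigenframe`, `exists_conj_fst_eq_glDiagonal_of_hyperbolic`)
import Literature.NumberTheory.Rogawski1990.LocalNormFibreNonsplit                       -- ★ `charpoly_endoEmbLocal` (`χ_{ι(γ_H)} = χ_g · (X − u)`)
import Literature.NumberTheory.Rogawski1990.LocalTransfer                                -- ★ `IsLocalGRegular`, `IsRegularElt`
import Literature.NumberTheory.Rogawski1990.UnitStableOrbitalIntegralIrredOneClass          -- ★ `adelicForm_antidiagTwo_local_hermitian`, `isUnit_det_adelicForm_antidiagTwo_local`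
import Mathlib.Algebra.Polynomial.SpecificDegree                                           -- `Monic.irreducible_iff_roots_eq_zero_of_degree_le_three`
import HarnessLib

/-!
# R90 · S6 «Ch. 14.1–14.5 stable TF» — «CLASSIFY» FILE C3: the TRICHOTOMY HEAD on `IsLocalGRegular` — a `G`-regular `γ_H ∈ H_v` is HYPERBOLIC (literal diagonal after
# one conjugation), of type (1) (split with two norm-one roots) or of type (2) (irreducible) (`Theorems/R90S6GRegularDiscriminantTrichotomy.lean`; T2-ASM census 15fbf54e §2 «CLASSIFY»)

Cell `hodgecm-mathlib`, crux H413 (`stmt-HodgeConjecture-24833`), route `HCCMUnconditional`; programme R90-TF, section S6 (base `R90-C14`); seat K2E3-p11 (g11)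
(«CLASSIFY» census 03:30:00Z; dealer R90-C14-plan (g3) :40 report «K2E3-p11 keeps C0 + C2 + the CM dress»).  Lane `--kind proof --supports stmt-HodgeConjecture-24833
--as helper`; THEOREMS ONLY (no definition, no instance, no notation, no named fact, no `sorry`).

## What the G5 assembler gets (`h_CLASSIFY` of K2E3-p34's scratch)
For `γ_H = (g, u) ∈ H_v = U(Φ₂)(L⁺_v) × U(Φ₁)(L⁺_v)` at a non-split place `v` of `L⁺` (`c • w = w`), `G`-REGULAR (`IsLocalGRegular L v γH`: `ι_v(γ_H)` regular semisimple),
write `χ_g` for the characteristic polynomial of `g` over `L ⊗ L⁺_v` (`= L_w`, a field) and `σ = c ⊗ 1`.  Then (`gRegular_trichotomy`) exactly one of: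
* (HYP) `χ_g = (X − r₀)(X − r₁)`, `r₀ ≠ r₁`, `σ(r₀) r₁ = 1`, neither root of norm one — and then (★ C0 `exists_conj_fst_eq_glDiagonal_of_hyperbolic`) some `h ∈ U(Φ₂)(L⁺_v)` puts
  `(h γ_H h⁻¹).1 = glDiagonal 2 d'`, the Levi letter `hd'` of the ★ hyperbolic payer (B2d) CLOSED p864596 — packaged here as `exists_conj_fst_eq_glDiagonal_of_gRegular_of_not_normOne`;
* (ELL-1) `χ_g = (X − a)(X − c)`, `a ≠ c`, `σ(a) a = σ(c) c = 1` — the hypothesis shape of the ELL-1 literal cell `R90S6GRegularCellsU2TypeOne` (K2E3-p17 (g12): `g ∼ δ₁(a,c) ∨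
  g ∼ δ_ϖ(a,c)`);
* (ELL-2) `χ_g` IRREDUCIBLE and separable — the hypothesis shape of the ELL-2 corner cell ★-GREEN `R90S6GRegularCellsU2TypeTwo.exists_conj_fst_eq_corner_of_irreducible`.
The separability of `χ_g` comes from `G`-regularity through ★ `charpoly_endoEmbLocal` (`χ_{ι(γ_H)} = χ_g · (X − u)`); the split∕irreducible dichotomy is «a monic quadratic over a
field has a root or is irreducible» (Mathlib `Monic.irreducible_iff_roots_eq_zero_of_degree_le_three`); the split case is ★ C0's Gram-matrix dichotomy.
NOT here: the valuation normalisation `|ρ| = |ϖ|`, `|C| = |ϖ^N|` of the type-(2) corner (C3b; ★ C2 `corner_rescale` + ★ `exists_valued_disc_eq_exp_neg_odd_of_not_exists_isRoot`).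
HONEST LABEL: helper algebra, count-neutral; HC_CM is proved only modulo the 7 printed citations (2 remaining named inputs: hLiu418 = stmt-HodgeConjecture-24832,
h413 = stmt-HodgeConjecture-24833) until rung 0 closes.

## References
* [Rogawski1990] J. D. Rogawski, *Automorphic Representations of Unitary Groups in Three Variables* (1990), §3.6 p. 31 (tori of `U(2)`: split, `E¹ × E¹`, `E¹ × (EK)¹`);
  §4.3 p. 42 (`G`-regular); §4.9 p. 55.
* [Flicker1998UnitaryFL] Y. Z. Flicker, *Elementary proof of the fundamental lemma for a unitary group*, Canad. J. Math. 50 (1998), §2 Prop. 3, §3 p. 80.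
-/

set_option autoImplicit false
set_option linter.dupNamespace false  -- the mandated namespace repeats the single-problem summit's segment (`HodgeConjecture.HodgeConjecture`)

noncomputable section

open Matrix NumberField IsDedekindDomain Polynomial
open Literature.NumberTheory.Automorphic Literature.NumberTheory.Automorphic.UnitaryGroup
open Literature.NumberTheory.Rogawski1990
open Literature.AlgebraicGeometry.ShimuraVarieties (unitaryGroup mem_unitaryGroup_iff unitaryGroup_eq_unitaryGroupOfForm)
open scoped Matrix MatrixGroups

namespace Summit.HodgeConjecture.HodgeConjecture.R90.S6

section CM

variable (L : Type) [Field L] [NumberField L] [IsCMField L] (v : HeightOneSpectrum (𝓞 ↥(maximalRealSubfield L)))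

/-- **`G`-regular ⇒ `χ_g` separable**: `χ_{ι_v(γ_H)} = χ_g · (X − u)` (★ `charpoly_endoEmbLocal`) is separable by `IsLocalGRegular`, hence so is its factor `χ_g`.
[cite: Rogawski1990, §4.3 p. 42] -/
theorem separable_charpoly_fst_of_isLocalGRegular
    (γH : (cmDatum L 2 (Matrix.of fun i j : Fin 2 => if i.val + j.val + 1 = 2 then (1 : L) else 0)).Local v ×
      (cmDatum L 1 (Matrix.of fun i j : Fin 1 => if i.val + j.val + 1 = 1 then (1 : L) else 0)).Local v)
    (hreg : IsLocalGRegular L v γH) : (γH.1.val : Matrix (Fin 2) (Fin 2) (LocalRing L v)).charpoly.Separable := by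
  have h3 : ((endoEmbLocal L v γH).val.val : Matrix (Fin 3) (Fin 3) (LocalRing L v)).charpoly.Separable := hreg
  rw [charpoly_endoEmbLocal] at h3
  exact h3.of_mul_left

/-- **THE TRICHOTOMY OF A `G`-REGULAR `γ_H = (g, u) ∈ H_v`** at a non-split place `v` of `L⁺` (`c • w = w`), on `χ_g` over the field `L ⊗ L⁺_v`, `σ = c ⊗ 1`:
(HYP) two distinct roots `r₀, r₁`, neither of norm one, with `σ(r₀) r₁ = 1`; or (ELL-1) two distinct roots `a, c` of norm one; or (ELL-2) `χ_g` irreducible (and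
separable).  A monic quadratic over a field has a root or is irreducible; in the split case the Gram-matrix dichotomy ★ C0 `normOne_or_hyperbolic_of_eigenframe` decides.
The three disjuncts are the hypothesis shapes of ★ C0 §3, of C1 (`R90S6GRegularCellsU2TypeOne`) and of ★ C2 §5 respectively. [cite: Rogawski1990, §3.6 p. 31; §4.3 p. 42]
[cite: Flicker1998UnitaryFL, §2 Prop. 3] -/
theorem gRegular_trichotomy (w : PlacesOver L v) (hw : IsCMField.complexConj L • w.1 = w.1)
    (γH : (cmDatum L 2 (Matrix.of fun i j : Fin 2 => if i.val + j.val + 1 = 2 then (1 : L) else 0)).Local v ×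
      (cmDatum L 1 (Matrix.of fun i j : Fin 1 => if i.val + j.val + 1 = 1 then (1 : L) else 0)).Local v)
    (hreg : IsLocalGRegular L v γH) :
    (∃ r : Fin 2 → LocalRing L v, Function.Injective r ∧ (γH.1.val : Matrix (Fin 2) (Fin 2) (LocalRing L v)).charpoly = ∏ i, (X - C (r i)) ∧
        conjLocal L (IsCMField.complexConj L) v (r 0) * r 0 ≠ 1 ∧ conjLocal L (IsCMField.complexConj L) v (r 1) * r 1 ≠ 1 ∧
        conjLocal L (IsCMField.complexConj L) v (r 0) * r 1 = 1) ∨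
    (∃ a c : LocalRing L v, a ≠ c ∧ (γH.1.val : Matrix (Fin 2) (Fin 2) (LocalRing L v)).charpoly = (X - C a) * (X - C c) ∧
        conjLocal L (IsCMField.complexConj L) v a * a = 1 ∧ conjLocal L (IsCMField.complexConj L) v c * c = 1) ∨
    (Irreducible (γH.1.val : Matrix (Fin 2) (Fin 2) (LocalRing L v)).charpoly ∧ (γH.1.val : Matrix (Fin 2) (Fin 2) (LocalRing L v)).charpoly.Separable) := by
  haveI : Algebra.IsQuadraticExtension ↥(maximalRealSubfield L) L := IsCMField.isQuadraticExtension L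
  letI : Field (LocalRing L v) :=
    (LocalRing.isField_of_smul_eq (IsCMField.complexConj L) (IsCMField.complexConj_ne_one L) w hw).toField
  have hσσ := conjLocal_conjLocal_cm L v
  have hsep := separable_charpoly_fst_of_isLocalGRegular L v γH hreg
  set χ : (LocalRing L v)[X] := (γH.1.val : Matrix (Fin 2) (Fin 2) (LocalRing L v)).charpoly with hχdef
  have hmonic : χ.Monic := Matrix.charpoly_monic _
  have hdeg : χ.natDegree = 2 := by rw [hχdef, Matrix.charpoly_natDegree_eq_dim, Fintype.card_fin]
  by_cases hroot : ∃ r₀, χ.IsRoot r₀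
  · obtain ⟨r₀, hr₀⟩ := hroot
    -- `χ = (X − r₀) · (X − r₁)` with `r₁ = tr g − r₀` (Vieta: `χ(r₀) = 0` gives `det g = r₀ (tr g − r₀)`)
    set r₁ : LocalRing L v := (γH.1.val : Matrix (Fin 2) (Fin 2) (LocalRing L v)).trace - r₀ with hr₁
    have hdet : (γH.1.val : Matrix (Fin 2) (Fin 2) (LocalRing L v)).det = r₀ * r₁ := by
      have h := hr₀
      rw [hχdef, Polynomial.IsRoot, Matrix.charpoly_fin_two] at h
      simp only [Polynomial.eval_add, Polynomial.eval_sub, Polynomial.eval_mul, Polynomial.eval_pow, Polynomial.eval_X, Polynomial.eval_C] at h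
      rw [hr₁]; linear_combination h
    have hχ2 : χ = (X - C r₀) * (X - C r₁) := by
      rw [hχdef, Matrix.charpoly_fin_two, hdet, show (γH.1.val : Matrix (Fin 2) (Fin 2) (LocalRing L v)).trace = r₀ + r₁ by rw [hr₁]; ring]
      simp only [map_add, map_mul]
      ring
    -- separable ⇒ `r₀ ≠ r₁`
    have hne : r₀ ≠ r₁ := by
      intro heq
      rw [← heq] at hχ2
      exact Polynomial.not_isUnit_X_sub_C _ (hsep.squarefree (X - C r₀) ⟨1, by rw [mul_one]; exact hχ2⟩)
    -- the eigenframe and ★ C0's Gram-matrix dichotomy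
    have hinj : Function.Injective ![r₀, r₁] := by
      intro i j hij
      fin_cases i <;> fin_cases j
      · rfl
      · exact absurd hij (by simpa using hne)
      · exact absurd hij (by simpa using hne.symm)
      · rfl
    have hχprod : (γH.1.val : Matrix (Fin 2) (Fin 2) (LocalRing L v)).charpoly = ∏ i, (X - C (![r₀, r₁] i)) := by
      rw [Fin.prod_univ_two]; exact hχ2
    obtain ⟨P, hP⟩ := exists_eigenframe_of_charpoly_eq_prod γH.1.val ![r₀, r₁] hinj hχprod
    have hΦ : cmLocalForm L 2 v = Matrix.of fun i j : Fin 2 => if i.val + j.val + 1 = 2 then (1 : LocalRing L v) else 0 := by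
      rw [cmLocalForm, UnitaryGroup.adelicForm_map_adeleToLocal]
      ext i j
      simp only [Matrix.map_apply, Matrix.of_apply]
      split_ifs <;> simp
    have hγ : (γH.1.val : GL (Fin 2) (LocalRing L v)) ∈
        unitaryGroupOfForm (conjLocal L (IsCMField.complexConj L) v) (Matrix.of fun i j : Fin 2 => if i.val + j.val + 1 = 2 then (1 : LocalRing L v) else 0) := by
      rw [← hΦ]; exact γH.1.2
    have hH : ((Matrix.of fun i j : Fin 2 => if i.val + j.val + 1 = 2 then (1 : LocalRing L v) else 0).map (conjLocal L (IsCMField.complexConj L) v))ᵀ =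
        Matrix.of fun i j : Fin 2 => if i.val + j.val + 1 = 2 then (1 : LocalRing L v) else 0 := by
      rw [← hΦ]; exact adelicForm_antidiagTwo_local_hermitian L v
    have hH0 : (Matrix.of fun i j : Fin 2 => if i.val + j.val + 1 = 2 then (1 : LocalRing L v) else 0).det ≠ 0 := by
      rw [← hΦ]; exact (isUnit_det_adelicForm_antidiagTwo_local L v).ne_zero
    rcases normOne_or_hyperbolic_of_eigenframe (conjLocal L (IsCMField.complexConj L) v) hσσ hH hH0 hγ hP hinj with ⟨h0, h1⟩ | ⟨h0, h1, h01⟩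
    · exact Or.inr (Or.inl ⟨r₀, r₁, hne, hχ2, h0, h1⟩)
    · exact Or.inl ⟨![r₀, r₁], hinj, hχprod, h0, h1, h01⟩
  · -- no root: a monic quadratic without roots is irreducible
    refine Or.inr (Or.inr ⟨?_, hsep⟩)
    rw [hmonic.irreducible_iff_roots_eq_zero_of_degree_le_three (by omega) (by omega), Multiset.eq_zero_iff_forall_notMem]
    intro r hr
    exact hroot ⟨r, (Polynomial.mem_roots hmonic.ne_zero).1 hr⟩

/-- **THE HYPERBOLIC BRANCH, PACKAGED**: a `G`-regular `γ_H` whose `χ_g` has a root NOT of norm one is conjugate in `H_v` to the Levi stratum (`hd'` of ★ B2d).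
[cite: Rogawski1990, §3.6 p. 31; §4.9 p. 55] -/
theorem exists_conj_fst_eq_glDiagonal_of_gRegular_of_not_normOne (w : PlacesOver L v) (hw : IsCMField.complexConj L • w.1 = w.1)
    (γH : (cmDatum L 2 (Matrix.of fun i j : Fin 2 => if i.val + j.val + 1 = 2 then (1 : L) else 0)).Local v ×
      (cmDatum L 1 (Matrix.of fun i j : Fin 1 => if i.val + j.val + 1 = 1 then (1 : L) else 0)).Local v)
    (hreg : IsLocalGRegular L v γH) {r₀ : LocalRing L v} (hr₀ : (γH.1.val : Matrix (Fin 2) (Fin 2) (LocalRing L v)).charpoly.IsRoot r₀)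
    (hN : conjLocal L (IsCMField.complexConj L) v r₀ * r₀ ≠ 1) :
    ∃ (h : (cmDatum L 2 (Matrix.of fun i j : Fin 2 => if i.val + j.val + 1 = 2 then (1 : L) else 0)).Local v)
      (d' : Fin 2 → (LocalRing L v)ˣ), (d' 0 : LocalRing L v) = r₀ ∧
        glDiagonal 2 (LocalRing L v) d' = ((h * γH.1 * h⁻¹ :
          (cmDatum L 2 (Matrix.of fun i j : Fin 2 => if i.val + j.val + 1 = 2 then (1 : L) else 0)).Local v).val : GL (Fin 2) (LocalRing L v)) := by
  haveI : Algebra.IsQuadraticExtension ↥(maximalRealSubfield L) L := IsCMField.isQuadraticExtension L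
  letI : Field (LocalRing L v) :=
    (LocalRing.isField_of_smul_eq (IsCMField.complexConj L) (IsCMField.complexConj_ne_one L) w hw).toField
  rcases gRegular_trichotomy L v w hw γH hreg with ⟨r, hr, hχ, h0, h1, h01⟩ | ⟨a, c, hac, hχ, ha, hc⟩ | ⟨hirr, -⟩
  · -- `r₀` is one of the two roots; reorder so that it comes first
    have hroots : r₀ = r 0 ∨ r₀ = r 1 := by
      have h := hr₀
      rw [Polynomial.IsRoot, hχ, Fin.prod_univ_two] at h
      simp only [Polynomial.eval_mul, Polynomial.eval_sub, Polynomial.eval_X, Polynomial.eval_C] at h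
      rcases mul_eq_zero.1 h with h' | h'
      · exact Or.inl (sub_eq_zero.1 h')
      · exact Or.inr (sub_eq_zero.1 h')
    rcases hroots with rfl | rfl
    · obtain ⟨h, d', hd', hdiag⟩ := exists_conj_fst_eq_glDiagonal_of_hyperbolic L v w hw γH hχ hr h0
      exact ⟨h, d', hd' 0, hdiag⟩
    · have hinj : Function.Injective (r ∘ Equiv.swap 0 1) := hr.comp (Equiv.injective _)
      have hχ' : (γH.1.val : Matrix (Fin 2) (Fin 2) (LocalRing L v)).charpoly = ∏ i, (X - C ((r ∘ Equiv.swap 0 1) i)) := by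
        rw [hχ, Fin.prod_univ_two, Fin.prod_univ_two]
        simp only [Function.comp_apply, Equiv.swap_apply_left, Equiv.swap_apply_right]
        ring
      obtain ⟨h, d', hd', hdiag⟩ := exists_conj_fst_eq_glDiagonal_of_hyperbolic L v w hw γH hχ' hinj (by simpa using h1)
      exact ⟨h, d', by simpa using hd' 0, hdiag⟩
  · -- both roots of norm one: contradicts `hN`
    exfalso
    have h := hr₀
    rw [Polynomial.IsRoot, hχ] at h
    simp only [Polynomial.eval_mul, Polynomial.eval_sub, Polynomial.eval_X, Polynomial.eval_C] at h
    rcases mul_eq_zero.1 h with h' | h'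
    · rw [sub_eq_zero] at h'; rw [h'] at hN; exact hN ha
    · rw [sub_eq_zero] at h'; rw [h'] at hN; exact hN hc
  · -- irreducible: no root at all
    exfalso
    have hdeg : (γH.1.val : Matrix (Fin 2) (Fin 2) (LocalRing L v)).charpoly.natDegree = 2 := by
      rw [Matrix.charpoly_natDegree_eq_dim, Fintype.card_fin]
    have hd := Polynomial.degree_eq_one_of_irreducible_of_root hirr hr₀
    rw [Polynomial.degree_eq_natDegree hirr.ne_zero, hdeg] at hd
    exact absurd hd (by decide)

/-- **THE `hCLASSIFY` INSTANCE OF THE (G5) ASSEMBLER** (`heckeFLAtFrame_of_cells`, dealer RULINGS #21): a `G`-regular `γ_H ∈ H_v` lies in the HYPERBOLIC cell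
`IsHypCell γ_H := ∃ h d', glDiagonal 2 _ d' = (h γ_H h⁻¹).1` (★ C0 currency), or in the ELL-1 cell (`χ_g = (X − a)(X − c)`, `a ≠ c`, both roots of norm one), or in
the ELL-2 cell (`χ_g` irreducible and separable).  [cite: Rogawski1990, §3.6 p. 31; §4.3 p. 42; §4.9 p. 55] [cite: Flicker1998UnitaryFL, §2 Prop. 3] -/
theorem gRegular_cells (w : PlacesOver L v) (hw : IsCMField.complexConj L • w.1 = w.1)
    (γH : (cmDatum L 2 (Matrix.of fun i j : Fin 2 => if i.val + j.val + 1 = 2 then (1 : L) else 0)).Local v ×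
      (cmDatum L 1 (Matrix.of fun i j : Fin 1 => if i.val + j.val + 1 = 1 then (1 : L) else 0)).Local v)
    (hreg : IsLocalGRegular L v γH) :
    (∃ (h : (cmDatum L 2 (Matrix.of fun i j : Fin 2 => if i.val + j.val + 1 = 2 then (1 : L) else 0)).Local v)
        (d' : Fin 2 → (LocalRing L v)ˣ),
        glDiagonal 2 (LocalRing L v) d' = ((h * γH.1 * h⁻¹ :
          (cmDatum L 2 (Matrix.of fun i j : Fin 2 => if i.val + j.val + 1 = 2 then (1 : L) else 0)).Local v).val : GL (Fin 2) (LocalRing L v))) ∨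
    (∃ a c : LocalRing L v, a ≠ c ∧ (γH.1.val : Matrix (Fin 2) (Fin 2) (LocalRing L v)).charpoly = (X - C a) * (X - C c) ∧
        conjLocal L (IsCMField.complexConj L) v a * a = 1 ∧ conjLocal L (IsCMField.complexConj L) v c * c = 1) ∨
    (Irreducible (γH.1.val : Matrix (Fin 2) (Fin 2) (LocalRing L v)).charpoly ∧ (γH.1.val : Matrix (Fin 2) (Fin 2) (LocalRing L v)).charpoly.Separable) := by
  rcases gRegular_trichotomy L v w hw γH hreg with ⟨r, hr, hχ, h0, -, -⟩ | hE1 | hE2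
  · obtain ⟨h, d', -, hdiag⟩ := exists_conj_fst_eq_glDiagonal_of_hyperbolic L v w hw γH hχ hr h0
    exact Or.inl ⟨h, d', hdiag⟩
  · exact Or.inr (Or.inl hE1)
  · exact Or.inr (Or.inr hE2)

end CM

end Summit.HodgeConjecture.HodgeConjecture.R90.S6

end
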